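import Summits.HodgeConjecture.FermatCycles.ConditionQKoblitzRohrlich
import Summits.HodgeConjecture.HodgeConjecture.Theorems.PadicSemiregularLiftHodgeFermatVarietiesTwinAssembly
import Summits.HodgeConjecture.HodgeConjecture.Theorems.PadicSemiregularLiftHodgeFermatVarietiesSigmaFiveOfFibre
import Summits.HodgeConjecture.HodgeConjecture.Theorems.PadicSemiregularLiftHodgeFermatVarietiesCoprimeSixPayoff
import HarnessLib

/-!
# `M'ₘ` is symmetric for every `m` prime to `6` — UNCONDITIONALLY; Shioda's `(Qₘ)`-question answered for `gcd(m, 6) = 1` (part 4 of the by-product)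

HONEST FRAMING: explicit algebraic cycles for specific Hodge classes on Fermat/Delsarte varieties;
residual open instances listed; no claim on general Hodge.

Topic path `Summits/HodgeConjecture/FermatCycles/` of cell `pub-hfermat`. Parts 1–3 (`ConditionQSymmetric`, `ConditionQCoprimeSix`,
`ConditionQKoblitzRohrlich`) proved: GRANTED Theorem K-R (a) of [Shioda1982PicardFermat] at `m` (an explicit hypothesis `hKR`), every element of
Shioda's `M'ₘ` is symmetric, hence `(Q⁴ₘ)` fails for `5 ∣ m` and `(Qₘ) ⟺ m` prime `⟺ (Pₘ)` for `gcd(m, 6) = 1`.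

THIS FILE REMOVES THE HYPOTHESIS for `gcd(m, 6) = 1`, using two theorems ALREADY PROVED IN THE TREE by the line
`cancel-by-any-claim-lattice` (crux `HodgeFermatVarieties`), both re-derivations of [Aoki1983] in the tree's vocabulary:
* `CancelByAnyClaimLattice.CoprimeSix.exists_pairing_of_four` (← the discharged fact `AokiShioda1983_thmB2m_coprime_six_holds`,
  [AokiShioda1983, §2 Thm (𝔅²ₘ) (i)] = [Shioda1982PicardFermat, Thm 6 (a)]): for `gcd(m, 6) = 1` every Hodge quadruple splits into two pairs;
* `CancelByAnyClaimLattice.PairedNull.stub_exists_fibre_of_not_paired_le_six` ([Aoki1983, Thm A′ §7, Prop. 2.2, Prop. 6.4], programme T6 of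
  that line, "everything proved"): for `gcd(m, 6) = 1`, a NON-SYMMETRIC Hodge multiset with `≤ 6` elements contains, for `p₁ ∈ {5, 7}` dividing `m`
  and some `A` with `p₁A ≠ 0`, all but one of the `p₁` points `A + j(m/p₁)` of a progression; and `CoprimeSix.stub_sigmaFive_of_fibre`: a Hodge
  SEXTUPLE containing four points of a `5`-progression is `σ_{5,A} = {A + j(m/5)} + {−5A}`.

THE ARGUMENT (`mPrime_symmetric_of_coprime_six`). Pairs are symmetric; Hodge quadruples are two pairs (first bullet). Let `s = T₁ + T₂` be a
semi-decomposable Hodge sextuple (`Tᵢ` zero-sum triples) and suppose it is not symmetric. KEY REMARK (`progression_triple_sum_ne_zero`): three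
points of a progression `A + j(m/p)`, `p ∣ m`, `pA ≠ 0`, never sum to `0` — the sum is `3A + c·(m/p)`, and `p · (3A + c(m/p)) = 3·pA ≠ 0` as `3` is a
unit. Case `p₁ = 7`: the six progression points are distinct members of the `6`-element `s`, so `s` consists of them (`progression_le`), and `T₁` is
three progression points summing to `0` — impossible. Case `p₁ = 5`: `s = σ_{5,A}` (second bullet); `−5A` is not a progression point and occurs once,
so one of `T₁, T₂` avoids it and consists of three progression points summing to `0` — impossible. Hence `s` is symmetric.

CONSEQUENCES, all UNCONDITIONAL for `gcd(m, 6) = 1` (`coprimeSix_consequences` and the named corollaries): `M'ₘ − M'ₘ` contains no non-symmetric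
multiset; `(Qⁿₘ)` fails for `n ≥ p − 1` whenever an odd `p = 2r+1 ≥ 5` divides `m` with `m/p ≥ 3`; **`(Q⁴ₘ)` fails for every `m` prime
to `6` with `5 ∣ m`, `m ≥ 25`** (`m = 25, 35, 55, 65, 85, 95, 115, …`; the six kernel certificates of the cell and Shioda's Appendix `m = 25` are
instances; beyond the fourfold table `(Q⁶₄₉)`, `(Q⁶₇₇)`, `(Q⁶₉₁)` fail); and **`(Qₘ) ⟺ m` prime `⟺ (Pₘ)` for every `m > 1` prime to `6`** — Shioda's
question [Shioda1979HodgeFermat, p. 184] ("we do not know any value of m which satisfies (Qₘ) but not (Pₘ)") has the answer "there is none prime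
to 6"; the cell's twenty levels `m ≤ 100` with `(Q⁴ₘ) ∧ ¬(P⁴ₘ)` are all even. What remains conditional: nothing in this file; parts 1–3 keep their
interest as the route through Theorem K-R (a) (whose hypothesis `hKR` is itself now seen to be CONSISTENT only for `gcd(m,6) = 1`, `coprime_six_of_KR`).

References: [Aoki1983] N. Aoki, Math. Ann. 266 (1983) 23–54, Thm A′ (§7), Prop. 5.1; [AokiShioda1983] N. Aoki, T. Shioda, in: Arithmetic and
Geometry I, Progr. Math. 35 (1983), §2 Thm (𝔅²ₘ); [Shioda1979HodgeFermat] T. Shioda, Math. Ann. 245 (1979) §4 pp. 183–184; [Shioda1981FermatType]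
T. Shioda, Math. Ann. 258 (1981), Appendix; [Shioda1982PicardFermat] T. Shioda, J. Fac. Sci. Univ. Tokyo IA 28 (1982), Thm 6 (a); [Aoki1987] N. Aoki,
J. Math. Soc. Japan 39 (1987) §1 (σ_{p,i}).
-/

namespace Summit.HodgeConjecture.FermatCycles.ConditionQPrimeToSix

open Multiset
open Literature.AlgebraicGeometry.HodgeTheory Literature.AlgebraicGeometry.HodgeTheory.FermatCharacter
open Literature.AlgebraicGeometry.Shioda1979 Literature.AlgebraicGeometry.Shioda1981
open Summit.HodgeConjecture.FermatCycles.ConditionQSymmetric Summit.HodgeConjecture.FermatCycles.ConditionQCoprimeSix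
open Summit.HodgeConjecture.HodgeConjecture.Theorems.CancelByAnyClaimLattice

variable {m : ℕ}

/-! ### Progressions `A + j(m/p)` -/

/-- **Three points of a progression never sum to zero**: for `p ∣ m`, `pA ≠ 0` and `3` a unit mod `m`,
`(A + i·m/p) + (A + j·m/p) + (A + k·m/p) ≠ 0` (multiply by `p`: `3·pA ≠ 0`). [folklore] -/
theorem progression_triple_sum_ne_zero [NeZero m] (h3 : Nat.Coprime 3 m) {p : ℕ} (hpm : p ∣ m) {A : ZMod m}
    (hA : (p : ZMod m) * A ≠ 0) (i j k : ℕ) :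
    A + (i : ZMod m) * ((m / p : ℕ) : ZMod m) + (A + (j : ZMod m) * ((m / p : ℕ) : ZMod m)) +
      (A + (k : ZMod m) * ((m / p : ℕ) : ZMod m)) ≠ 0 := by
  intro h
  have hpd : (p : ZMod m) * ((m / p : ℕ) : ZMod m) = 0 := by
    rw [← Nat.cast_mul, Nat.mul_div_cancel' hpm, ZMod.natCast_self]
  have h3u : IsUnit (3 : ZMod m) := by
    have hu := (ZMod.unitOfCoprime 3 h3).isUnit
    rwa [ZMod.coe_unitOfCoprime, Nat.cast_ofNat] at hu
  have e : (3 : ZMod m) * ((p : ZMod m) * A) = 0 := by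
    linear_combination (p : ZMod m) * h - ((i : ZMod m) + j + k) * hpd
  exact hA (h3u.mul_right_eq_zero.mp e)

/-- A zero-sum triple cannot consist of progression points. [folklore] -/
theorem false_of_triple_progression [NeZero m] (h3 : Nat.Coprime 3 m) {p : ℕ} (hpm : p ∣ m) {A : ZMod m}
    (hA : (p : ZMod m) * A ≠ 0) {v : Multiset (ZMod m)} (hv3 : card v = 3) (hvs : v.sum = 0)
    (hprog : ∀ y ∈ v, ∃ i : ℕ, y = A + (i : ZMod m) * ((m / p : ℕ) : ZMod m)) : False := by
  obtain ⟨y₁, y₂, y₃, rfl⟩ := Multiset.card_eq_three.mp hv3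
  obtain ⟨i₁, h₁⟩ := hprog y₁ (by simp)
  obtain ⟨i₂, h₂⟩ := hprog y₂ (by simp)
  obtain ⟨i₃, h₃⟩ := hprog y₃ (by simp)
  simp only [insert_eq_cons, sum_cons, sum_singleton] at hvs
  rw [h₁, h₂, h₃] at hvs
  exact progression_triple_sum_ne_zero h3 hpm hA i₁ i₂ i₃ (by linear_combination hvs)

/-- **Distinct progression points form a sub-multiset**: for `S ⊆ {0, …, p−1}` with `A + j(m/p) ∈ q` for all `j ∈ S`, the multiset
`{A + j(m/p) : j ∈ S}` (no repetition, as `j(m/p) < m` determines `j`) is `≤ q`. [folklore] -/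
theorem progression_le [NeZero m] {p : ℕ} (hpm : p ∣ m) {A : ZMod m} (S : Finset ℕ) (hS : ∀ j ∈ S, j < p)
    (q : Multiset (ZMod m)) (hmem : ∀ j ∈ S, A + (j : ZMod m) * ((m / p : ℕ) : ZMod m) ∈ q) :
    S.val.map (fun j : ℕ ↦ A + (j : ZMod m) * ((m / p : ℕ) : ZMod m)) ≤ q := by
  have hm0 : 0 < m := Nat.pos_of_ne_zero (NeZero.ne m)
  have hd0 : 0 < m / p := Nat.div_pos (Nat.le_of_dvd hm0 hpm) (Nat.pos_of_dvd_of_pos hpm hm0)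
  have hpd : p * (m / p) = m := Nat.mul_div_cancel' hpm
  refine (Multiset.le_iff_subset ?_).mpr ?_
  · refine Multiset.Nodup.map_on (fun i hi j hj hij ↦ ?_) S.nodup
    have hi' := hS i hi
    have hj' := hS j hj
    have e : ((i * (m / p) : ℕ) : ZMod m) = ((j * (m / p) : ℕ) : ZMod m) := by
      push_cast; exact add_left_cancel hij
    rw [ZMod.natCast_eq_natCast_iff'] at e
    have hi2 : i * (m / p) < m := by
      calc i * (m / p) < p * (m / p) := Nat.mul_lt_mul_of_pos_right hi' hd0
        _ = m := hpd
    have hj2 : j * (m / p) < m := by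
      calc j * (m / p) < p * (m / p) := Nat.mul_lt_mul_of_pos_right hj' hd0
        _ = m := hpd
    rw [Nat.mod_eq_of_lt hi2, Nat.mod_eq_of_lt hj2] at e
    exact Nat.eq_of_mul_eq_mul_right hd0 e
  · intro y hy
    obtain ⟨j, hj, rfl⟩ := Multiset.mem_map.mp hy
    exact hmem j hj

/-! ### The theorem: `M'ₘ` is symmetric for `gcd(m, 6) = 1` -/

/-- `3` is prime to `m` when `m` is prime to `6`. [folklore] -/
theorem coprime_three_of_coprime_six (h6 : Nat.Coprime m 6) : Nat.Coprime 3 m :=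
  (Nat.Coprime.coprime_dvd_right (by norm_num : 3 ∣ 6) h6).symm

/-- A semi-decomposable Hodge sextuple at a level prime to `6` is symmetric (the heart of the matter; replaces Theorem K-R (a)).
[cite: Aoki1983, Thm A′ (§7)] [cite: Shioda1979HodgeFermat, §4 p. 183 (M'ₘ)] -/
theorem isSymmetric_of_isSemiDecomposable [NeZero m] (h6 : Nat.Coprime m 6) {s : Multiset (ZMod m)}
    (hs : IsHodgeMultiset s) (h6c : card s = 6) (hsd : IsSemiDecomposable s) : IsSymmetric s := by
  have h3 := coprime_three_of_coprime_six h6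
  obtain ⟨t, u, ht3, hu3, hts, hus, rfl⟩ := hsd
  by_contra hns
  obtain ⟨x, hx⟩ : ∃ x, count x (t + u) ≠ count (-x) (t + u) := by
    by_contra hall
    push Not at hall
    exact hns hall
  obtain ⟨p₁, hp57, hp₁m, A, hA, j₀, hj₀, hfib⟩ :=
    PairedNull.stub_exists_fibre_of_not_paired_le_six m h6 (t + u) hs (by rw [h6c]) ⟨x, hx⟩
  rcases hp57 with rfl | rfl
  · -- `p₁ = 5`: `t + u = σ_{5,A}`
    rcases CoprimeSix.stub_sigmaFive_of_fibre m h6 hp₁m (t + u) hs h6c A hA ⟨j₀, hj₀, hfib⟩ with ⟨Q, -, hQ⟩ | hσ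
    · exact hns (by rw [hQ]; exact isSymmetric_add_map_neg Q)
    · set w : ZMod m := -((5 : ZMod m) * A) with hw_def
      have h5d : ((5 : ℕ) : ZMod m) * ((m / 5 : ℕ) : ZMod m) = 0 := by
        rw [← Nat.cast_mul, Nat.mul_div_cancel' hp₁m, ZMod.natCast_self]
      -- `w` is not a progression point: `6A + i(m/5) = 0` would give `6·5A = 0`
      have hw : ∀ i : ℕ, A + (i : ZMod m) * ((m / 5 : ℕ) : ZMod m) ≠ w := by
        intro i hi
        have h6u : IsUnit (6 : ZMod m) := by
          have hu := (ZMod.unitOfCoprime 6 h6.symm).isUnit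
          rwa [ZMod.coe_unitOfCoprime, Nat.cast_ofNat] at hu
        apply hA
        have e : (6 : ZMod m) * (((5 : ℕ) : ZMod m) * A) = 0 := by
          rw [hw_def] at hi
          push_cast at hi ⊢
          linear_combination (5 : ZMod m) * hi - (i : ZMod m) * h5d
        have := h6u.mul_right_eq_zero.mp e
        exact_mod_cast this
      -- members of `t + u` other than `w` are progression points
      have hmem : ∀ y ∈ t + u, y ≠ w → ∃ i : ℕ, y = A + (i : ZMod m) * ((m / 5 : ℕ) : ZMod m) := by
        intro y hy hne
        rw [hσ] at hy
        rcases Multiset.mem_add.mp hy with hy | hy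
        · obtain ⟨i, -, rfl⟩ := Multiset.mem_map.mp hy
          exact ⟨i, rfl⟩
        · exact absurd (Multiset.mem_singleton.mp hy) hne
      -- `w` occurs exactly once in `t + u`
      have hcount : count w (t + u) = 1 := by
        rw [hσ, Multiset.count_add, Multiset.count_singleton_self, Multiset.count_eq_zero.mpr, zero_add]
        intro hmw
        obtain ⟨i, -, hi⟩ := Multiset.mem_map.mp hmw
        exact hw i hi
      by_cases hwt : w ∈ t
      · -- then `w ∉ u`, and `u` consists of progression points
        have hwu : w ∉ u := by
          have h1 : 1 ≤ count w t := Multiset.one_le_count_iff_mem.mpr hwt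
          rw [Multiset.count_add] at hcount
          exact Multiset.count_eq_zero.mp (by omega)
        exact false_of_triple_progression h3 hp₁m (by exact_mod_cast hA) hu3 hus fun y hy ↦
          hmem y (Multiset.mem_add.mpr (Or.inr hy)) fun h ↦ hwu (h ▸ hy)
      · exact false_of_triple_progression h3 hp₁m (by exact_mod_cast hA) ht3 hts fun y hy ↦
          hmem y (Multiset.mem_add.mpr (Or.inl hy)) fun h ↦ hwt (h ▸ hy)
  · -- `p₁ = 7`: the six progression points fill `t + u`
    set S : Finset ℕ := (Finset.range 7).erase j₀ with hS_def
    have hSlt : ∀ j ∈ S, j < 7 := fun j hj ↦ Finset.mem_range.mp (Finset.mem_of_mem_erase hj)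
    have hSmem : ∀ j ∈ S, A + (j : ZMod m) * ((m / 7 : ℕ) : ZMod m) ∈ t + u := fun j hj ↦
      hfib j (hSlt j hj) (Finset.ne_of_mem_erase hj)
    have hle := progression_le hp₁m S hSlt (t + u) hSmem
    have hScard : S.card = 6 := by
      rw [hS_def, Finset.card_erase_of_mem (Finset.mem_range.mpr hj₀), Finset.card_range]
    have heq := Multiset.eq_of_le_of_card_le hle (by rw [Multiset.card_map, Finset.card_val, hScard, h6c])
    have hmem : ∀ y ∈ t + u, ∃ i : ℕ, y = A + (i : ZMod m) * ((m / 7 : ℕ) : ZMod m) := by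
      intro y hy
      rw [← heq] at hy
      obtain ⟨i, -, rfl⟩ := Multiset.mem_map.mp hy
      exact ⟨i, rfl⟩
    exact false_of_triple_progression h3 hp₁m (by exact_mod_cast hA) ht3 hts fun y hy ↦
      hmem y (Multiset.mem_add.mpr (Or.inl hy))

/-- A Hodge quadruple at a level prime to `6` is symmetric (two pairs, by the tree's Aoki–Shioda theorem).
[cite: AokiShioda1983, §2 Theorem (𝔅²ₘ) (i)] [cite: Shioda1982PicardFermat, Thm 6 (a) p. 731] -/
theorem isSymmetric_of_card_four [NeZero m] (h6 : Nat.Coprime m 6) {q : Multiset (ZMod m)}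
    (hq : IsHodgeMultiset q) (h4 : card q = 4) : IsSymmetric q := by
  obtain ⟨a, b, c, d, rfl⟩ := Multiset.card_eq_four.mp h4
  rcases CoprimeSix.exists_pairing_of_four h6 hq with ⟨h1, h2⟩ | ⟨h1, h2⟩ | ⟨h1, h2⟩
  · have hb : b = -a := by linear_combination h1
    have hd : d = -c := by linear_combination h2
    subst hb hd
    have e : ({a, -a, c, -c} : Multiset (ZMod m)) = {a, -a} + {c, -c} := by
      simp only [insert_eq_cons, cons_add, singleton_add]
    rw [e]
    exact isSymmetric_add (isSymmetric_pair a) (isSymmetric_pair c)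
  · have hc : c = -a := by linear_combination h1
    have hd : d = -b := by linear_combination h2
    subst hc hd
    have e : ({a, b, -a, -b} : Multiset (ZMod m)) = {a, -a} + {b, -b} := by
      simp only [insert_eq_cons, cons_add, singleton_add]
      rw [Multiset.cons_swap b (-a)]
    rw [e]
    exact isSymmetric_add (isSymmetric_pair a) (isSymmetric_pair b)
  · have hd : d = -a := by linear_combination h1
    have hc : c = -b := by linear_combination h2
    subst hc hd
    have e : ({a, b, -b, -a} : Multiset (ZMod m)) = {b, -b} + {a, -a} := by
      simp only [insert_eq_cons, cons_add, singleton_add]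
      rw [Multiset.cons_swap a b, Multiset.cons_swap a (-b)]
    rw [e]
    exact isSymmetric_add (isSymmetric_pair b) (isSymmetric_pair a)

/-- **`M'ₘ` is symmetric for every `m` prime to `6`** — no hypothesis: every element of the monoid generated by the pairs, the Hodge
quadruples and the semi-decomposable Hodge sextuples has symmetric multiplicities `x_ν = x_{m−ν}`. (Shioda's Appendix argument for
`m = 25`, [Shioda1981FermatType], for all `m` prime to `6`.) [cite: Shioda1981FermatType, Appendix pp. 78–79] [cite: Aoki1983, Thm A′ (§7)] -/
theorem mPrime_symmetric_of_coprime_six [NeZero m] (h6 : Nat.Coprime m 6) : ∀ ξ ∈ MPrime m, IsSymmetric ξ := by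
  intro ξ hξ
  induction hξ using AddSubmonoid.closure_induction with
  | mem g hg =>
    obtain ⟨hH, h2 | h4 | ⟨h6c, hsd⟩⟩ := hg
    · obtain ⟨a, -, rfl⟩ := hH.eq_pair_of_card_eq_two h2
      exact isSymmetric_pair a
    · exact isSymmetric_of_card_four h6 hH h4
    · exact isSymmetric_of_isSemiDecomposable h6 hH h6c hsd
  | zero => exact isSymmetric_zero
  | add x y _ _ hx hy => exact isSymmetric_add hx hy

/-! ### Consequences, unconditional for `gcd(m, 6) = 1` -/

/-- A non-symmetric multiset is not stably in `M'ₘ` (`m` prime to `6`). [cite: Shioda1979HodgeFermat, §4 (Qₘ) p. 183] -/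
theorem not_stablyMem_of_coprime_six [NeZero m] (h6 : Nat.Coprime m 6) {s : Multiset (ZMod m)} (hns : ¬ IsSymmetric s) :
    ¬ ∃ ξ₁ ∈ MPrime m, ∃ ξ₂ ∈ MPrime m, s + ξ₂ = ξ₁ := by
  rintro ⟨ξ₁, h₁, ξ₂, h₂, heq⟩
  have hs1 := mPrime_symmetric_of_coprime_six h6 ξ₁ h₁
  rw [← heq] at hs1
  exact hns (isSymmetric_of_add_right hs1 (mPrime_symmetric_of_coprime_six h6 ξ₂ h₂))

/-- **The consequences, collected** (`m` prime to `6`; no other hypothesis): (i) `(Qⁿₘ)` fails for `n ≥ p − 1` whenever an odd `p = 2r+1 ≥ 5`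
divides `m` with `m/p ≥ 3`; (ii) `(Q⁴ₘ)` fails for `5 ∣ m`, `m ≥ 15` (so for `m = 25, 35, 55, 65, 85, 95, 115, …`); (iii) for `m > 1`:
`(Qₘ) ⟺ m` prime, `(Pₘ) ⟺ m` prime, `(Qₘ) ⟺ (Pₘ)` — Shioda's question has a negative answer for every `m` prime to `6`.
[cite: Shioda1979HodgeFermat, §4 pp. 183–184 (conditions (Pₘ), (Qₘ); the question p. 184)] [cite: Shioda1981FermatType, Appendix (m = 25)]
[cite: Aoki1983, Thm A′ (§7)] [cite: Aoki1987, §1 p. 387 (σ_{p,1})] -/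
theorem coprimeSix_consequences [NeZero m] (h6 : Nat.Coprime m 6) :
    (∀ r n : ℕ, 2 ≤ r → 2 * r + 1 ∣ m → 3 ≤ m / (2 * r + 1) → 2 * r ≤ n → ¬ ConditionQ m n) ∧
    (5 ∣ m → 15 ≤ m → ¬ ConditionQ m 4) ∧
    (1 < m → (ConditionQAll m ↔ m.Prime) ∧ (ShiodaCondition m ↔ m.Prime) ∧ (ConditionQAll m ↔ ShiodaCondition m)) := by
  have hQn : ∀ r n : ℕ, 2 ≤ r → 2 * r + 1 ∣ m → 3 ≤ m / (2 * r + 1) → 2 * r ≤ n → ¬ ConditionQ m n := by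
    intro r n hr hpm hd hn hQ
    have h3 : 3 * (2 * r + 1) ≤ m := (Nat.le_div_iff_mul_le (by omega)).1 hd
    exact not_stablyMem_of_coprime_six h6 (not_isSymmetric_aokiStandard_one (by omega) hpm hd)
      (hQ _ (isHodgeMultiset_aokiStandard_one hpm (by omega)) (by rw [card_aokiStandard_one]; omega)
        (by rw [card_aokiStandard_one]; omega))
  have hQAll : 1 < m → (ConditionQAll m ↔ m.Prime) := by
    intro h1
    constructor
    · intro hQ
      by_contra hnp
      obtain ⟨p, hp, hpm⟩ := Nat.exists_prime_and_dvd (show m ≠ 1 by omega)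
      have hp2 : p ≠ 2 := by
        rintro rfl
        have : Nat.Coprime 2 6 := Nat.Coprime.coprime_dvd_left hpm h6
        norm_num at this
      have hp3 : p ≠ 3 := by
        rintro rfl
        have : Nat.Coprime 3 6 := Nat.Coprime.coprime_dvd_left hpm h6
        norm_num at this
      have hp5 : 5 ≤ p := by
        have h2 := hp.two_le
        rcases Nat.lt_or_ge p 5 with h | h
        · exfalso
          interval_cases p
          · exact hp2 rfl
          · exact hp3 rfl
          · exact absurd hp (by decide)
        · exact h
      obtain ⟨d, hd⟩ := hpm
      have hd1 : d ≠ 1 := by rintro rfl; exact hnp (by simpa [hd] using hp)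
      have hd0 : d ≠ 0 := by rintro rfl; simp [hd] at h1
      have hdcop : Nat.Coprime d 6 := Nat.Coprime.coprime_dvd_left ⟨p, by rw [hd, mul_comm]⟩ h6
      have hd2 : d ≠ 2 := by rintro rfl; norm_num at hdcop
      have hd3 : d ≠ 3 := by rintro rfl; norm_num at hdcop
      have hd4 : d ≠ 4 := by rintro rfl; norm_num at hdcop
      have hd5 : 5 ≤ d := by omega
      have hmp : m / p = d := by rw [hd]; exact Nat.mul_div_cancel_left d hp.pos
      obtain ⟨r, rfl⟩ := hp.odd_of_ne_two hp2
      have hlt : 2 * r + 1 < m := by rw [hd]; nlinarith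
      exact not_stablyMem_of_coprime_six h6
        (not_isSymmetric_aokiStandard_one (r := r) (by omega) ⟨d, hd⟩ (by rw [hmp]; omega))
        (hQ _ (isHodgeMultiset_aokiStandard_one ⟨d, hd⟩ hlt))
    · intro hp
      haveI : Fact m.Prime := ⟨hp⟩
      exact conditionQAll_of_shiodaCondition shiodaCondition_of_prime
  refine ⟨hQn, fun h5 hm ↦ hQn 2 4 le_rfl h5 (by show 3 ≤ m / 5; omega) le_rfl, fun h1 ↦ ?_⟩
  have hP : ShiodaCondition m ↔ m.Prime :=
    ⟨fun hPm ↦ (hQAll h1).1 (conditionQAll_of_shiodaCondition hPm), fun hp ↦ by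
      haveI : Fact m.Prime := ⟨hp⟩
      exact shiodaCondition_of_prime⟩
  exact ⟨hQAll h1, hP, (hQAll h1).trans hP.symm⟩

/-- **`(Q⁴ₘ)` fails for every `m` prime to `6` with `5 ∣ m`, `m ≥ 15`** (`m = 25, 35, 55, 65, 85, 95, 115, …`) — unconditionally.
[cite: Shioda1979HodgeFermat, §4 (Q⁴ₘ) pp. 183–184] [cite: Shioda1981FermatType, Appendix (m = 25)] [cite: Aoki1983, Thm A′ (§7)] -/
theorem not_conditionQ_four_of_coprime_six [NeZero m] (h6 : Nat.Coprime m 6) (h5 : 5 ∣ m) (hm : 15 ≤ m) :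
    ¬ ConditionQ m 4 :=
  (coprimeSix_consequences h6).2.1 h5 hm

/-- **Shioda's question for `m` prime to `6`, unconditionally: `(Qₘ) ⟺ (Pₘ)` (`⟺ m` prime)** — no `m > 1` prime to `6` satisfies `(Qₘ)`
but not `(Pₘ)`. [cite: Shioda1979HodgeFermat, §4 p. 184 (the question)] [cite: Aoki1983, Thm A′ (§7)] -/
theorem conditionQAll_iff_shiodaCondition_of_coprime_six [NeZero m] (h6 : Nat.Coprime m 6) (h1 : 1 < m) :
    (ConditionQAll m ↔ ShiodaCondition m) ∧ (ConditionQAll m ↔ m.Prime) :=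
  ⟨((coprimeSix_consequences h6).2.2 h1).2.2, ((coprimeSix_consequences h6).2.2 h1).1⟩

/-! ### `M'ₘ = ⟨Mₘ(1)⟩` for `gcd(m, 6) = 1`: Shioda's `m = 25` sentence, in general -/

/-- **For `m` prime to `6`, `M'ₘ` is generated by the pairs alone** — "the sub-semigroup `M'ₘ` of `Mₘ` generated by `Mₘ(1)`, `Mₘ(2)` and
semi-decomposable elements of `Mₘ(3)` is the same as one generated by `Mₘ(1)`", printed for `m = 25` [Shioda1981FermatType, Appendix p. 78–79],
holds for every `m` prime to `6`: each generator is a symmetric Hodge multiset (`mPrime_symmetric_of_coprime_six`), hence `Q + (−Q)`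
(tree: `CoprimeSix.exists_pairs_of_count_symm`), a sum of pairs. [cite: Shioda1981FermatType, Appendix pp. 78–79]
[cite: Shioda1979HodgeFermat, §4 p. 183 (M'ₘ, Mₘ(1))] [cite: Aoki1983, Thm A′ (§7)] -/
theorem mPrime_eq_closure_pairs_of_coprime_six [NeZero m] (h6 : Nat.Coprime m 6) :
    MPrime m = AddSubmonoid.closure {s : Multiset (ZMod m) | ∃ a : ZMod m, a ≠ 0 ∧ s = {a, -a}} := by
  apply le_antisymm
  · refine AddSubmonoid.closure_le.mpr fun g hg ↦ ?_
    have hsym : IsSymmetric g := mPrime_symmetric_of_coprime_six h6 g (mem_mPrime_of_mem hg)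
    obtain ⟨Q, hQ0, rfl⟩ := CoprimeSix.exists_pairs_of_count_symm h6 _ g rfl hg.1 hsym
    clear hg hsym
    induction Q using Multiset.induction with
    | empty => simp
    | cons a Q ih =>
      have ha : a ≠ 0 := hQ0 a (Multiset.mem_cons_self a Q)
      have e : (a ::ₘ Q) + (a ::ₘ Q).map (fun x ↦ -x) = ({a, -a} : Multiset (ZMod m)) + (Q + Q.map (fun x ↦ -x)) := by
        simp only [Multiset.map_cons, Multiset.cons_add, Multiset.add_cons, insert_eq_cons, singleton_add]
        rw [Multiset.cons_swap]
      rw [SetLike.mem_coe, e]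
      exact AddSubmonoid.add_mem _ (AddSubmonoid.subset_closure ⟨a, ha, rfl⟩)
        (ih fun b hb ↦ hQ0 b (Multiset.mem_cons_of_mem hb))
  · refine AddSubmonoid.closure_le.mpr fun s hs ↦ ?_
    obtain ⟨a, ha, rfl⟩ := hs
    exact mem_mPrime_of_mem ⟨IsHodgeMultiset.pair ha, Or.inl (by simp)⟩

end Summit.HodgeConjecture.FermatCycles.ConditionQPrimeToSix
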